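import Summits.CriticalPhenomena.PercolationContinuityZ3.Theorems.Transplant.SkelConcFaceRouteKits
import HarnessLib

/-!
# Kozma–Nitzan Lemma 12 over a planar skeleton — the face residue of the concentric scheme of record WITH THE KIT CLAUSES DISCHARGED
# (hp-8 (F) closing file; generic twin of the product's `BoxProdZ2ConcFaceRun.faceOblR_concGB`)

builds on p205010 (kernel theorem, internal audit signed; external expert review pending) — nothing in this file uses p205010.
Lane `prim-bschramm`, typed by the `prim-hp-8` lineage (gen 24); helper file (`--supports stmt-CriticalPhenomena-4575 --as helper`).  NEW FILE
over `SkelConcFaceObl` (`Skel.faceOblR_concS`) and `SkelConcFaceRouteKits` (`Skel.hkits_faceStepW_kits`).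

**`faceOblR_concS_kits`**: `Skel.FaceOblR Φ ⟨cellGeomSG Φ C w₀ (concRadiiS C gap gap' E₀ L'), q, δc⟩ (faceDataSG …) Δ' δ₂` — the face-step
obligation of the general node's concentric scheme — from: the schedule numerics (`1 ≤ gap`, `20 r ≤ gap`, `2 ≤ E₀`, `1 ≤ L'`,
`20 r + 2 L' + R₁ ρ ≤ gap ρ`), the face count, the rim excess radius `R₁` at the running parameter, and the KIT INPUTS of
`hkits_faceStepW_kits`: the Step-I input family at `q` over `Φ.types × Ssc` (margin `am ≤ min(δ₂², δA²)`), the seed-kit constants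
(`ℓs, R', r₀, rs`; `tanOff ℓs M ≤ Mj + 1`, `r₀ + 1 ≤ L'`), the outer/inner counts, the rim width `L_A + ψ M + 1 ≤ L'`, the inner-run numerics
(`s₁, R'ᵢ, ℓ₀, ℓ1, nmax, RlevA, L_A, L'_A`), the route scales `{M, ℓ1} ∪ [ℓ₀, ℓ₁A] ⊆ Ssc`, the multi-step chain estimate `hchain` at inner
accuracy `δA` delivering `δ₂²`, the inner count and the centre-uniform inner excess radius `R₁A`.  The realised radii on a valid history
(`rM = E g + gap(E g) − L'`, `rE = E g + gap(E g) − 1`, `g = nQ a x`) supply the rim numerics.  THIS BINDER LIST IS BLOCK (B) for stmt's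
`SkelConcParamsFace`.
[cite: KozmaNitzan2024, §4 Lemma 12 (pp. 23–24), Lemma 10 (pp. 17–21), Lemma 11 (pp. 22–23), p. 30]
-/

noncomputable section

open MeasureTheory
open scoped Classical

namespace Summit.CriticalPhenomena.PercolationContinuityZ3.Theorems

namespace Transplant

namespace Skel

open Literature.Probability.Percolation Literature.Probability.LatticeModels SimpleGraph KNCells KNLevels GadgetSystem Contour
open Literature.Probability.Percolation.KozmaNitzan
open Literature.Probability.Percolation.KozmaNitzan.Cells (oth oth_ne sgOf sgOf_sign stepVec_apply_fst stepVec_apply_oth eq_oth_of_ne oth_oth)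
open Literature.Barriers.CriticalPhenomena (graphBall graphBall_finite mem_graphBall_self graphBall_mono)
open BoxProdZ2 (ConcRadiiG Erad Frad nQ nS Realised Frad_succ Frad_le_Erad)
open PlanarSkeletonConc

open SkelI (tanOff)

variable {V : Type} [DecidableEq V] [Countable V] {G : SimpleGraph V} [G.LocallyFinite] (Φ : PlanarSkeletonConc G)

section Realised

variable (C : PCells) (w₀ : V) (gap gap' : ℕ → ℕ) (E₀ L' : ℕ) (q : unitInterval) (δc : ℝ)

/-- **The face residue of the concentric scheme of record, kit clauses discharged** (see the module docstring).
[cite: KozmaNitzan2024, §4 Lemma 12 (pp. 23–24), Lemma 11 (pp. 22–23)] -/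
theorem faceOblR_concS_kits (hgap : ∀ n, 1 ≤ gap n) (hgap20 : ∀ n, 20 * C.r ≤ gap n) (hE₀ : 2 ≤ E₀) (hL' : 1 ≤ L') (hφ : Φ.φ w₀ = 0)
    {Δ' Rlev N Mj : ℕ} {δ₂ : ℝ} (hRlev : Rlev + 4 ≤ 10 * C.s)
    (hcount : 1 / (1 - (q : ℝ)) ^ (Δ' * N) ≤ δ₂ * ((Finset.Icc (Mj + 1) Rlev).card : ℝ))
    {η : ℝ} (hη : η ≤ δc / 2) (R₁ : ℕ → ℕ)
    (hR₁ : ∀ ρ R', R₁ ρ ≤ R' → ∀ (Rw : ℕ) (D' A' : Finset V), (∀ d ∈ D', d ∈ graphBall G w₀ Rw) →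
      (∀ d ∈ D', ∀ d' ∈ D', Φ.φ d - Φ.φ d' ∈ box 2 (50 * C.r)) → A' ⊆ D' → (∀ a ∈ A', a ∈ graphBall G w₀ (ρ + 1)) →
        (bondPercolation G q).real (excess G w₀ R' D' A') ≤ η)
    (hgapR : ∀ ρ, 20 * C.r + 2 * L' + R₁ ρ ≤ gap ρ)
    -- the Step-I input family at the running parameter (margin am ≤ δ₂², am ≤ δA) and the kit constants
    {p₀ : unitInterval} (hC : Φ.toPlanarSkeleton.CylSubcritical p₀) (msel : V → ℕ) {Ssc : Finset ℕ} {δA am : ℝ} (hδ : 0 < δ₂)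
    (ham₂ : am ≤ δ₂ ^ 2) (hin : ∀ i ∈ Skel.inputIndex Φ Ssc, 1 - am < (bondPercolation G q).real (Skel.inputEvent Φ hC msel i))
    {M : ℕ} (hM : M ∈ Ssc) (hmsel : ∀ t ∈ Φ.types, msel t ≤ M) {ℓs R' r₀ rs k : ℕ} (hMℓ : M + 1 ≤ ℓs) (hMj : tanOff ℓs M ≤ Mj + 1)
    (hR'₁ : Φ.cylRadMax ℓs (ℓs + 2 + 2 * tanOff ℓs M) ≤ R') (hR'₂ : Φ.cylRadMax ℓs (ℓs + 2 + M + fatRadius Φ hC M) ≤ R')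
    (hr₀₁ : ℓs + 1 + tanOff ℓs M + R' ≤ r₀) (hr₀₂ : 2 * ℓs + 2 + tanOff ℓs M + M + fatRadius Φ hC M ≤ r₀)
    (hrs₁ : ℓs + 2 + tanOff ℓs M + R' ≤ rs) (hrs₂ : 2 * ℓs + 3 + tanOff ℓs M + M + fatRadius Φ hC M ≤ rs)
    (hN : k * (Φ.Δ + 1) ^ (2 * rs) ≤ N)
    (hk : (1 - (q : ℝ) ^ (1 + Φ.Δ * ((Φ.Δ + 1) ^ R' + (tanOff ℓs M + 2)) +
      ((Φ.Δ + 1) ^ R' + (tanOff ℓs M + 2)) * (Φ.Δ + 1) ^ fatRadius Φ hC M)) ^ k ≤ δ₂)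
    -- the rim numerics
    (hr₀L' : r₀ + 1 ≤ L')
    {L_A : ℕ} (hLd : L_A + fatRadius Φ hC M + 1 ≤ L')
    -- the inner route package (`Skel.hroute_face`) at inner accuracy δA, for every cube centre `oc`
    {s₁ R'ᵢ ℓ₀ ℓ1 nmax j₀A RlevA N_A L'_A : ℕ} (hℓ1S : ℓ1 ∈ Ssc) (hMℓ₀ : M < ℓ₀) (hs : R'ᵢ + ℓ₀ ≤ s₁) (hs2 : 2 * R'ᵢ ≤ s₁)
    (hℓ1 : M + s₁ + 2 * R'ᵢ + 1 ≤ ℓ1) (hn : 12 * C.r ≤ nmax * s₁) (hbig : Rlev + ℓ1 + 2 * s₁ + (nmax + 3) * R'ᵢ ≤ C.r)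
    (h10s : Rlev + ℓ1 + 3 ≤ 10 * C.s) (hRlA : RlevA + 1 ≤ R'ᵢ) (hℓL : fatRadius Φ hC ℓ1 ≤ L_A) (hLA : 28 * C.r + 2 * Rlev ≤ L_A)
    {Δ'ᵢ : ℕ} {ηA : ℝ}
    (hchain : ∀ (oc : V), ∀ n ≤ nmax, ∀ (Wg : Sym2 V → unitInterval) (s : Fin (n + 1) → TStep (winGraph G oc L_A)) (T' : Fin (n + 1) → Finset V) (η' : ℝ),
      (∀ i, (s i).L.o = (s 0).L.o) →
      (∀ i : Fin n, T' (Fin.castSucc i) ⊆ (s i.succ).L.X 0) →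
      (∀ i, T' i ⊆ (s i).T) →
      (∀ i, (s i).KitsAt Wg q Δ'ᵢ δA) →
      η' ≤ δA / 2 →
      (∀ i, (prodBernoulli Wg).real (⋃ t ∈ (s i).T \ T' i, openConn (s 0).L.o t) ≤ η') →
      1 - δA < (prodBernoulli Wg).real (s 0).L.reachB →
        1 - δ₂ ^ 2 < (prodBernoulli Wg).real (⋃ t ∈ T' (Fin.last n), openConn (s 0).L.o t))
    (hcountA : 1 / (1 - (q : ℝ)) ^ (Δ'ᵢ * N_A) ≤ δA * ((Finset.Icc j₀A RlevA).card : ℝ))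
    -- the inner kits at accuracy δA: input margin `am ≤ δA²`, route scales `[ℓ₀, ℓ₁A] ⊆ Ssc`, inner level window above `T₀`, counts
    (hδA : 0 < δA) (hδA1 : δA ≤ 1) (hamA : am ≤ δA ^ 2) {ℓ₁A kkA : ℕ} (hℓ₁A : (s₁ : ℤ) + R'ᵢ ≤ ℓ₁A)
    (hSsc : ∀ ℓ, ℓ₀ ≤ ℓ → ℓ ≤ ℓ₁A → ℓ ∈ Ssc) (hj₀A : tanOff ℓs M ≤ j₀A) (hr₀LA : r₀ ≤ L'_A)
    (hLψA : fatRadius Φ hC ℓ₁A + fatRadius Φ hC M ≤ L'_A) (hLRA : L'_A ≤ L_A) (hNA : kkA * (Φ.Δ + 1) ^ (2 * rs) ≤ N_A)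
    (hkA : (1 - (q : ℝ) ^ (1 + Φ.Δ * ((Φ.Δ + 1) ^ R' + (tanOff ℓs M + 2)) +
      ((Φ.Δ + 1) ^ R' + (tanOff ℓs M + 2)) * (Φ.Δ + 1) ^ fatRadius Φ hC M)) ^ kkA ≤ δA)
    (hηA : ηA ≤ δA / 2) {R₁A : ℕ}
    (hR₁A : ∀ (c' : V) (R'' : ℕ), R₁A ≤ R'' → ∀ (Rw : ℕ) (D' A' : Finset V), (∀ d ∈ D', d ∈ graphBall G c' Rw) →
      (∀ d ∈ D', ∀ d' ∈ D', Φ.φ d - Φ.φ d' ∈ box 2 (50 * C.r)) → A' ⊆ D' → (∀ a ∈ A', a ∈ graphBall G c' (2 * fatRadius Φ hC M)) →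
        (bondPercolation G q).real (excess G c' R'' D' A') ≤ ηA)
    (hRA : R₁A ≤ L_A - L'_A) :
    FaceOblR Φ (⟨cellGeomSG Φ C w₀ (concRadiiS C gap gap' E₀ L'), q, δc⟩ : KSchA V ℕ)
      (faceDataSG Φ C w₀ (concRadiiS C gap gap' E₀ L')) Δ' δ₂ := by
  have hΛ : WFS C (concRadiiS C gap gap' E₀ L') := concRadiiS_WFS C gap gap' E₀ L' hgap hE₀ hL'
  refine faceOblR_concS (Φ := Φ) C w₀ gap gap' E₀ L' q δc hgap hgap20 hE₀ hL' hφ (M := Mj) hRlev hcount hη R₁ hR₁ hgapR ?_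
  intro h e Λ S hrun hc hV du hdu j hj o
  have hr : Realised (S.aOf₁ G h e) (S.aOf₂ G h e) (tgt e) := realised_of_choice_SG h hc
  have hy : tgt e + stepVec du ≠ 0 := tgt_add_stepVec_ne_zero hφ hV hdu
  -- the realised radii: `rE = E g + gap (E g) − 1`, `rM = E g + gap (E g) − L'` (`g = nQ a x`)
  have hrM : Λ.rM (S.aOf₂ G h e) (tgt e + stepVec du) =
      Erad gap gap' E₀ (nQ (S.aOf₁ G h e) (tgt e)) + gap (Erad gap gap' E₀ (nQ (S.aOf₁ G h e) (tgt e))) - L' := by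
    change Frad gap gap' E₀ (nQ (S.aOf₂ G h e) (tgt e + stepVec du)) - L' = _
    rw [hr.nQ_add_stepVec hy, Frad_succ]
  have hrE : Λ.rE (S.aOf₂ G h e) (tgt e) du =
      Erad gap gap' E₀ (nQ (S.aOf₁ G h e) (tgt e)) + gap (Erad gap gap' E₀ (nQ (S.aOf₁ G h e) (tgt e))) - 1 := by
    change (concRadiiS C gap gap' E₀ L').rE (S.aOf₂ G h e) (tgt e) du = _
    rw [concRadiiS_rE_eq C gap gap' E₀ L' (by rw [hr.nQ_add_stepVec hy, hr.nS_eq]), hr.nS_eq, Frad_succ]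
  have hgapg := hgapR (Erad gap gap' E₀ (nQ (S.aOf₁ G h e) (tgt e)))
  obtain ⟨τ, hτ⟩ : ∃ τ : ℤˣ, (τ : ℤ) = sgOf du := by
    rcases sgOf_sign du with h1 | h1
    · exact ⟨1, by simp [h1]⟩
    · exact ⟨-1, by simp [h1]⟩
  exact hkits_faceStepW_kits Φ (S := S) rfl hΛ hV hdu Rlev N Mj L' hj (by omega) hC msel hδ ham₂ hin hM hmsel hMℓ hMj hR'₁ hR'₂ hr₀₁ hr₀₂
    (by rw [hrE]; omega) hrs₁ hrs₂ hN hk hL' (by rw [hrM]; omega) (by rw [hrM, hrE]; omega) hLd hℓ1S hMℓ₀ hs hs2 hℓ1 hn hbig h10s hRlA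
    hℓL hLA hτ hchain hcountA hδA hδA1 hamA hℓ₁A hSsc hj₀A hr₀LA hLψA hLRA hNA hkA hηA hR₁A hRA

end Realised

end Skel

end Transplant

end Summit.CriticalPhenomena.PercolationContinuityZ3.Theorems

end
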